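import Summits.CriticalPhenomena.PercolationContinuityZ3.Theorems.PercNearOneGluingNoHeavyQuantChemicalRadiusSteepness
import Summits.CriticalPhenomena.PercolationContinuityZ3.Theorems.PercNearOneGluingNoHeavyQuantChemicalOneArm
import Literature.Probability.FitznerVanDerHofstad2017.MeanFieldExponents
import Literature.Barriers.CriticalPhenomena.LaceExpansionHighDimensionTriangleHolds
import HarnessLib

/-!
# THE CRITICAL CHEMICAL RADIUS IN EVERY DIMENSION: `P_{p_c}(Rad_int(C(0)) ≥ r) ≥ 1/(e(r+3))` on `ℤ^d`, all `d ≥ 2`, all `r`;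
# the LOSSLESS chemical (T2)-dictionary `θ(p) ≤ (p/p_c)^r P_{p_c}(Rad_int ≥ r)` (chemical exponent `b` ⟹ Hölder exponent `b`);
# two-sided `≍ 1/r` under the triangle condition / in high dimensions — quant lane, seat p4 gen 38, file 3

builds on p205010 (kernel theorem, internal audit signed; external expert review pending) — NOT used in this file.
Seat `prim-quant-p4`, `--supports stmt-CriticalPhenomena-4575`; pure proofs, no definitions.

All statements are for bond percolation `P_p` on `ℤ^d`, `far ℤ^d 0 r = {∂B_int(0, r) ≠ ∅} = {Rad_int(C(0)) ≥ r}` (the tree's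
`Chemical.far (zdGraph d) 0 r`), `p_c = criticalProbI d`, `θ = theta (zdGraph d) 0`.  Input: file 2's closing-pivotal steepness
`P_q(far r) ≤ (q/p)^r P_p(far r)` (`0 < p ≤ q < 1`), the inclusion `{|C(0)| = ∞} ⊆ {Rad_int ≥ r}` a.s., and the
Duminil-Copin–Tassion / Aizenman–Barsky mean-field bound `θ(q) ≥ (q − p_c)/(q(1 − p_c))` (tree).

* §1 `ChemRad.theta_le_real_far`, `ChemRad.pow_mul_theta_le_real_far` — `θ(q) ≤ P_q(far r)` and
  `(p/q)^r θ(q) ≤ P_p(far r)` (`0 < p ≤ q < 1`).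
* §2 **`ChemRad.real_far_criticalProbI_ge`** — for EVERY `d ≥ 2` and every `r`: `P_{p_c}(Rad_int(C(0)) ≥ r) ≥ 1/(e(r+3))`
  (take `q = p_c + p_c(1−p_c)/(r+2)`: `(p_c/q)^r ≥ e^{-1}`, `θ(q) ≥ 1/(r+3)`); **`ChemRad.real_far_subcritical_ge`** — for
  `0 < p ≤ p_c`: `P_p(Rad_int ≥ r) ≥ (p/p_c)^r/(e(r+3))` (Hutchcroft's Prop. 4.2 `≥ c r^{-1} e^{-C(p_c−p) r}` on `ℤ^d`, with the
  constants explicit and dimension-free).  So the critical CHEMICAL one-arm exponent is `≤ 1` in every dimension — with NO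
  hypothesis (the extrinsic one-arm has only `π_n(p_c) ≥ c n^{-(d-1)}`-type a-priori bounds in `d = 3`).
* §3 **`ChemRad.theta_le_pow_mul_real_far_criticalProbI`** — `θ(p) ≤ (p/p_c)^r P_{p_c}(Rad_int ≥ r)` (`p_c ≤ p < 1`, every `r`);
  **`ChemRad.thetaHolderNearCritical_of_real_far_le`**, **`ChemRad.thetaHolderNearCritical_of_armSup_le`** — the LOSSLESS
  (T2)-dictionary: `P_{p_c}(Rad_int ≥ r) ≤ B r^{-b}` (`b > 0`; a fortiori Kozma–Nachmias' `Γ_{p_c}(r) ≤ B r^{-b}`, the SIXTH FACE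
  of the landmark, `…QuantChemicalOneArm`) ⟹ `Quant.ThetaHolderNearCritical d b C` with THE SAME exponent `b`
  (`C = max(e^{1/p_c} B p_c^{-b}, (1−p_c)^{-b})`; `r = ⌈p_c/(p−p_c)⌉`).  Compare the extrinsic dictionary
  `…ThetaModulusR4.thetaHolderNearCritical_of_oneArmPolyDecay` (`c ↦ 2c/(c+d)`) and Newman's volume route (`1/δ ↦ 2/δ`).
  **`ChemRad.real_far_supercrit_window_le`** — inside `r(p − p_c) ≤ p_c`: `P_p(Rad_int ≥ r) ≤ e · P_{p_c}(Rad_int ≥ r)`.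
* §4 **`ChemRad.real_far_criticalProbI_two_sided_of_triangle`**, **`…_high_dim`** — `TriangleCondition d` (tree theorem for
  `d ≥ D`, `HaraSlade1990_triangleCondition_holds`) ⟹ `1/(e(r+3)) ≤ P_{p_c}(Rad_int ≥ r) ≤ C/r` (upper half = Kozma–Nachmias
  2009 Thm 1.2(ii) via the tree's recursion `Quant.chemicalArm_powerLaw_of_volumeTail` at `a = 1/2`); and
  **`ChemRad.thetaHolder_one_of_triangle_chemical`** — `θ(p) ≤ C(p − p_c)`, i.e. `β ≥ 1`, by the CHEMICAL route (third kernel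
  route to Barsky–Aizenman's upper bound, after Hutchcroft 2022 Thm 1.3 and `…ThetaVolumeTransfer`).

HONEST STATUS.  §2 is Hutchcroft 2022 Prop. 4.2 (every quasi-transitive graph; here `ℤ^d`) with explicit dimension-free constants —
REPRODUCTION-level, first formalisation; the high-`d` two-sided statement is Kozma–Nachmias 2009 Thm 1.2(ii) / HvdH Thm 11.5 (there
the lower half needs the two-point function; here it is hypothesis-free); §3's lossless dictionary row is NEW AS TYPED (implicit in
Hutchcroft's Lemma 2.1).  For `3 ≤ d ≤ 6` the chemical decay hypothesis is OPEN like every face of the landmark.  NO rate, NO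
exponent for `d = 3`; (T1)/(T2) and the lane's honest sentence UNCHANGED.

References: T. Hutchcroft, Proc. Lond. Math. Soc. 125 (2022), arXiv:2002.02916, Lemma 2.1, Prop. 4.2 [Hutchcroft2022SlightlySupercritical];
G. Kozma, A. Nachmias, Invent. Math. 178 (2009) Thm 1.2 [KozmaNachmias2009]; M. Heydenreich, R. van der Hofstad (2017) Thm 11.5,
Open Problem 11.2 [HeydenreichVanDerHofstad2017]; H. Duminil-Copin, V. Tassion, Enseign. Math. 62 (2016) Thm 1.1(2)
[DuminilCopinTassionEM2016].
-/

noncomputable section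

namespace Summit.CriticalPhenomena.PercolationContinuityZ3.Theorems

open MeasureTheory Set Filter Topology Literature.Probability.Percolation Literature.Probability.LatticeModels
open Literature.Probability.Percolation.Chemical Literature.Probability.FitznerVanDerHofstad2017
open scoped Classical

namespace ChemRad

variable {d : ℕ}

/-! ### §1. `{|C(0)| = ∞} ⊆ {Rad_int(C(0)) ≥ r}`: `θ(q) ≤ P_q(far r)` and `(p/q)^r θ(q) ≤ P_p(far r)` -/

/-- An infinite open cluster reaches every chemical distance (lattice configurations `ω ⊆ E(ℤ^d)`): the sites at open-graph
distance `< r` from `0` lie in the finite box `Λ_r`. [folklore] -/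
theorem mem_far_of_percolatesAt {ω : BondConfig (Site d)} (hω : ω ⊆ (zdGraph d).edgeSet) (r : ℕ)
    (h : ω ∈ percolatesAt (0 : Site d)) : ω ∈ far (zdGraph d) (0 : Site d) r := by
  have hle : openGraph ω ≤ zdGraph d := fun a b hab => (SimpleGraph.mem_edgeSet _).1 (hω ((openGraph_adj ω a b).1 hab).1)
  have heq : openGraph ω ⊓ zdGraph d = openGraph ω := inf_eq_left.2 hle
  rw [far, Set.mem_setOf_eq, heq]
  by_contra hno
  push Not at hno
  refine h ((box d r).finite_toSet.subset fun y (hy : (openGraph ω).Reachable 0 y) => ?_)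
  obtain ⟨w, hw⟩ := hy.exists_walk_length_eq_dist
  have hlt := hno y hy
  have hmem := mem_box_of_mem_support (w.map (SimpleGraph.Hom.ofLE hle)) (zero_mem_box d 0) y
    (SimpleGraph.Walk.end_mem_support _)
  rw [SimpleGraph.Walk.length_map, zero_add, hw] at hmem
  exact box_mono d hlt.le hmem

/-- **`θ(q) ≤ P_q(Rad_int(C(0)) ≥ r)`** for every `q` and `r`. [folklore] -/
theorem theta_le_real_far (q : unitInterval) (r : ℕ) :
    theta (zdGraph d) 0 q ≤ (bondPercolation (zdGraph d) q).real (far (zdGraph d) (0 : Site d) r) :=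
  DCT16.real_mono_of_forall_subset_edgeSet (zdGraph d) q fun _ hω h => mem_far_of_percolatesAt hω r h

/-- **`(p/q)^r · θ(q) ≤ P_p(Rad_int(C(0)) ≥ r)`** for `0 < p ≤ q < 1`: the density of the infinite cluster at the HIGHER
parameter bounds the chemical one-arm probability at the LOWER one (file 2 + §1). [cite: Hutchcroft2022SlightlySupercritical, Prop. 4.2 (proof)] -/
theorem pow_mul_theta_le_real_far (r : ℕ) (p q : unitInterval) (hp0 : 0 < (p : ℝ)) (hpq : (p : ℝ) ≤ q)
    (hq1 : (q : ℝ) < 1) :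
    ((p : ℝ) / q) ^ r * theta (zdGraph d) 0 q ≤ (bondPercolation (zdGraph d) p).real (far (zdGraph d) (0 : Site d) r) :=
  (mul_le_mul_of_nonneg_left (theta_le_real_far q r) (pow_nonneg (div_nonneg hp0.le (hp0.le.trans hpq)) r)).trans
    (pow_mul_real_far_le_real_far r p q hp0 hpq hq1)

/-! ### §2. Every `d ≥ 2`: `P_{p_c}(Rad_int ≥ r) ≥ 1/(e(r+3))`, and the subcritical form -/

/-- `e^{-1} ≤ (1/(1 + x/(r+2)))^r` for `0 ≤ x ≤ 1` (from `1 + t ≤ e^t` and `r x/(r+2) ≤ 1`). [folklore] -/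
theorem exp_neg_one_le_pow_div {x : ℝ} (hx0 : 0 ≤ x) (hx1 : x ≤ 1) (r : ℕ) :
    Real.exp (-1) ≤ (1 / (1 + x / (r + 2))) ^ r := by
  have hr : (0 : ℝ) < r + 2 := by positivity
  have hb : 0 < 1 + x / (r + 2) := by positivity
  have hle : (1 + x / (r + 2)) ^ r ≤ Real.exp 1 := by
    calc (1 + x / (r + 2)) ^ r ≤ Real.exp (x / (r + 2)) ^ r :=
          pow_le_pow_left₀ hb.le (by linarith [Real.add_one_le_exp (x / (r + 2))]) r
      _ = Real.exp (r * (x / (r + 2))) := by rw [← Real.exp_nat_mul]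
      _ ≤ Real.exp 1 := Real.exp_le_exp.2 (by
          rw [mul_div_assoc', div_le_one hr]
          nlinarith [mul_le_of_le_one_right (Nat.cast_nonneg r : (0 : ℝ) ≤ r) hx1])
  rw [one_div, inv_pow, Real.exp_neg]
  exact inv_anti₀ (pow_pos hb r) hle

/-- **THE CRITICAL CHEMICAL RADIUS, EVERY `d ≥ 2`: `P_{p_c}(Rad_int(C(0)) ≥ r) ≥ 1/(e·(r+3))` for every `r`.**  Proof: with
`q = p_c(1 + (1−p_c)/(r+2)) < 1`, `P_{p_c}(far r) ≥ (p_c/q)^r θ(q) ≥ e^{-1} · (q−p_c)/(q(1−p_c)) = e^{-1}/(r+3−p_c)`.  The constants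
are explicit and free of `d`; the chemical one-arm exponent at criticality is thus `≤ 1` in every dimension, with no hypothesis.
[cite: Hutchcroft2022SlightlySupercritical, Prop. 4.2] -/
theorem real_far_criticalProbI_ge (hd : 2 ≤ d) (r : ℕ) :
    1 / (Real.exp 1 * (r + 3)) ≤ (bondPercolation (zdGraph d) (criticalProbI d)).real (far (zdGraph d) (0 : Site d) r) := by
  have hd1 : 1 ≤ d := by omega
  set pc : ℝ := (criticalProbI d : ℝ) with hpc
  have hpc0 : 0 < pc := by rw [hpc, coe_criticalProbI]; exact criticalProb_zd_pos d hd1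
  have hpc1 : pc < 1 := by rw [hpc, coe_criticalProbI]; exact criticalProb_zd_lt_one hd
  have hr : (0 : ℝ) < r + 2 := by positivity
  -- the comparison parameter `q = p_c (1 + (1 - p_c)/(r+2))`
  set qr : ℝ := pc * (1 + (1 - pc) / (r + 2)) with hqr
  have hq_gt : pc < qr := by
    rw [hqr]; nlinarith [div_pos (by linarith : (0:ℝ) < 1 - pc) hr]
  have hq_lt : qr < 1 := by
    rw [hqr]
    have h1 : (1 - pc) / (r + 2) ≤ (1 - pc) := div_le_self (by linarith) (by linarith)
    nlinarith
  let q : unitInterval := ⟨qr, (hpc0.trans hq_gt).le, hq_lt.le⟩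
  have hqv : (q : ℝ) = qr := rfl
  -- `P_{p_c}(far r) ≥ (p_c/q)^r θ(q)`
  have hmain := pow_mul_theta_le_real_far (d := d) r (criticalProbI d) q hpc0 (by rw [hqv]; exact hq_gt.le)
    (by rw [hqv]; exact hq_lt)
  -- `θ(q) ≥ (q - p_c)/(q (1 - p_c)) ≥ 1/(r+3)`
  have hθ : 1 / ((r : ℝ) + 3) ≤ theta (zdGraph d) 0 q := by
    have hmf := DCT16.perc_meanField_bound_holds hd q (by rw [hqv, ← coe_criticalProbI]; exact hq_gt)
    rw [← coe_criticalProbI] at hmf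
    refine le_trans ?_ hmf
    rw [hqv, div_le_div_iff₀ (by positivity) (mul_pos (hpc0.trans hq_gt) (by linarith))]
    have key : (qr - pc) * ((r : ℝ) + 3) - 1 * (qr * (1 - pc)) = pc ^ 2 * (1 - pc) / (r + 2) := by
      rw [hqr]; field_simp; ring
    have : 0 ≤ pc ^ 2 * (1 - pc) / (r + 2) := div_nonneg (mul_nonneg (sq_nonneg _) (by linarith)) hr.le
    linarith
  have hpow : Real.exp (-1) ≤ (pc / qr) ^ r := by
    have : pc / qr = 1 / (1 + (1 - pc) / (r + 2)) := by
      rw [hqr]; field_simp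
    rw [this]; exact exp_neg_one_le_pow_div (by linarith) (by linarith) r
  calc 1 / (Real.exp 1 * (r + 3)) = Real.exp (-1) * (1 / ((r : ℝ) + 3)) := by rw [Real.exp_neg]; field_simp
    _ ≤ (pc / qr) ^ r * theta (zdGraph d) 0 q :=
        mul_le_mul hpow hθ (by positivity) (pow_nonneg (div_nonneg hpc0.le (hpc0.le.trans hq_gt.le)) r)
    _ ≤ _ := hmain

/-- **SUBCRITICAL FORM, every `d ≥ 2`: `P_p(Rad_int(C(0)) ≥ r) ≥ (p/p_c)^r / (e·(r+3))` for `0 < p ≤ p_c`** (Hutchcroft's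
`P_p(Rad_int ≥ r) ≥ c r^{-1} e^{-C(p_c−p) r}` on `ℤ^d` with explicit, dimension-free constants: `(p/p_c)^r = (1 − s/p_c)^r`).
[cite: Hutchcroft2022SlightlySupercritical, Prop. 4.2] -/
theorem real_far_subcritical_ge (hd : 2 ≤ d) (r : ℕ) (p : unitInterval) (hp0 : 0 < (p : ℝ))
    (hpc : (p : ℝ) ≤ criticalProbI d) :
    ((p : ℝ) / criticalProbI d) ^ r / (Real.exp 1 * (r + 3)) ≤
      (bondPercolation (zdGraph d) p).real (far (zdGraph d) (0 : Site d) r) := by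
  have hpc1 : (criticalProbI d : ℝ) < 1 := by rw [coe_criticalProbI]; exact criticalProb_zd_lt_one hd
  have h1 := pow_mul_real_far_le_real_far (d := d) r p (criticalProbI d) hp0 hpc hpc1
  have h2 := real_far_criticalProbI_ge hd r
  have hnn : 0 ≤ ((p : ℝ) / criticalProbI d) ^ r := pow_nonneg (div_nonneg hp0.le (hp0.le.trans hpc)) r
  calc ((p : ℝ) / criticalProbI d) ^ r / (Real.exp 1 * (r + 3)) = ((p : ℝ) / criticalProbI d) ^ r * (1 / (Real.exp 1 * (r + 3))) := by
        rw [mul_one_div]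
    _ ≤ ((p : ℝ) / criticalProbI d) ^ r * (bondPercolation (zdGraph d) (criticalProbI d)).real (far (zdGraph d) (0 : Site d) r) :=
        mul_le_mul_of_nonneg_left h2 hnn
    _ ≤ _ := h1

/-! ### §3. Upwards from `p_c`: the lossless chemical (T2)-dictionary -/

/-- **`θ(p) ≤ (p/p_c)^r · P_{p_c}(Rad_int(C(0)) ≥ r)`** for `p_c ≤ p < 1` and every `r`, every `d ≥ 2`: the density of the
infinite cluster is controlled by the CRITICAL chemical one-arm probability at the scale `r ≍ p_c/(p − p_c)` (where
`(p/p_c)^r ≤ e`). [cite: Hutchcroft2022SlightlySupercritical, Lemma 2.1 (first display of the proof)] -/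
theorem theta_le_pow_mul_real_far_criticalProbI (hd : 2 ≤ d) (r : ℕ) (p : unitInterval)
    (hpc : (criticalProbI d : ℝ) ≤ p) (hp1 : (p : ℝ) < 1) :
    theta (zdGraph d) 0 p ≤ ((p : ℝ) / criticalProbI d) ^ r *
      (bondPercolation (zdGraph d) (criticalProbI d)).real (far (zdGraph d) (0 : Site d) r) := by
  have hpc0 : 0 < (criticalProbI d : ℝ) := by rw [coe_criticalProbI]; exact criticalProb_zd_pos d (by omega)
  exact (theta_le_real_far p r).trans (real_far_le_pow_mul_real_far r (criticalProbI d) p hpc0 hpc hp1)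

/-- `(p/p_c)^r ≤ exp(r (p − p_c)/p_c)` for `p_c ≤ p` (`1 + t ≤ e^t`). [folklore] -/
theorem div_pow_le_exp {pc p : ℝ} (hpc0 : 0 < pc) (hpcp : pc ≤ p) (r : ℕ) :
    (p / pc) ^ r ≤ Real.exp (r * ((p - pc) / pc)) := by
  rw [Real.exp_nat_mul]
  refine pow_le_pow_left₀ (div_nonneg (hpc0.le.trans hpcp) hpc0.le) ?_ r
  have : p / pc = (p - pc) / pc + 1 := by field_simp; ring
  rw [this]
  exact Real.add_one_le_exp _

/-- **Inside the supercritical window `r(p − p_c) ≤ p_c` the chemical one-arm probability is at most `e` times its critical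
value**: `P_p(Rad_int ≥ r) ≤ e · P_{p_c}(Rad_int ≥ r)` (`p_c ≤ p < 1`). [cite: Hutchcroft2022SlightlySupercritical, Lemma 2.1] -/
theorem real_far_supercrit_window_le (hd : 2 ≤ d) (r : ℕ) (p : unitInterval) (hpc : (criticalProbI d : ℝ) ≤ p)
    (hp1 : (p : ℝ) < 1) (hwin : (r : ℝ) * ((p : ℝ) - criticalProbI d) ≤ criticalProbI d) :
    (bondPercolation (zdGraph d) p).real (far (zdGraph d) (0 : Site d) r) ≤
      Real.exp 1 * (bondPercolation (zdGraph d) (criticalProbI d)).real (far (zdGraph d) (0 : Site d) r) := by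
  have hpc0 : 0 < (criticalProbI d : ℝ) := by rw [coe_criticalProbI]; exact criticalProb_zd_pos d (by omega)
  refine (real_far_le_pow_mul_real_far r (criticalProbI d) p hpc0 hpc hp1).trans
    (mul_le_mul_of_nonneg_right ?_ measureReal_nonneg)
  refine (div_pow_le_exp hpc0 hpc r).trans (Real.exp_le_exp.2 ?_)
  rw [mul_div_assoc', div_le_one hpc0]
  exact hwin

/-- **THE LOSSLESS CHEMICAL (T2)-DICTIONARY.**  If the critical chemical one-arm probability on `ℤ^d` (`d ≥ 2`) satisfies
`P_{p_c}(Rad_int(C(0)) ≥ r) ≤ B r^{-b}` for all `r ≥ 1` with `b > 0`, then `θ(p) ≤ C (p − p_c)^b` for ALL `p ≥ p_c` — the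
lane's `Quant.ThetaHolderNearCritical d b C` with THE SAME exponent `b`, `C = max(e^{1/p_c} B p_c^{-b}, (1−p_c)^{-b})`
(take `r = ⌈p_c/(p−p_c)⌉`; at `p = p_c` the bound forces `θ(p_c) = 0`; `p = 1` is covered by the second constant).
[cite: Hutchcroft2022SlightlySupercritical, Lemma 2.1] -/
theorem thetaHolderNearCritical_of_real_far_le (hd : 2 ≤ d) {b B : ℝ} (hb : 0 < b)
    (hB : ∀ r : ℕ, 1 ≤ r →
      (bondPercolation (zdGraph d) (criticalProbI d)).real (far (zdGraph d) (0 : Site d) r) ≤ B * (r : ℝ) ^ (-b)) :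
    Quant.ThetaHolderNearCritical d b
      (max (Real.exp (1 / criticalProbI d) * B * (criticalProbI d : ℝ) ^ (-b)) ((1 - (criticalProbI d : ℝ)) ^ (-b))) := by
  have hd1 : 1 ≤ d := by omega
  intro p hpc
  set pc : ℝ := (criticalProbI d : ℝ) with hpcdef
  have hpc0 : 0 < pc := by rw [hpcdef, coe_criticalProbI]; exact criticalProb_zd_pos d hd1
  have hpc1 : pc < 1 := by rw [hpcdef, coe_criticalProbI]; exact criticalProb_zd_lt_one hd
  have hB0 : 0 ≤ B := by
    have := hB 1 le_rfl
    simp only [Nat.cast_one, Real.one_rpow, mul_one] at this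
    exact measureReal_nonneg.trans this
  set C : ℝ := max (Real.exp (1 / pc) * B * pc ^ (-b)) ((1 - pc) ^ (-b)) with hC
  have hC0 : 0 ≤ C := le_max_of_le_right (Real.rpow_nonneg (by linarith) _)
  rcases eq_or_lt_of_le hpc with heq | hlt
  · -- `p = p_c`: `θ(p_c) ≤ B r^{-b}` for every `r ≥ 1`, hence `θ(p_c) ≤ 0 = C · 0^b`
    rw [← heq, sub_self, Real.zero_rpow hb.ne', mul_zero]
    have hθ : ∀ r : ℕ, 1 ≤ r → theta (zdGraph d) 0 p ≤ B * (r : ℝ) ^ (-b) := fun r hr => by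
      have h := theta_le_pow_mul_real_far_criticalProbI hd r p hpc (by rw [← heq]; exact hpc1)
      rw [← heq, div_self hpc0.ne', one_pow, one_mul] at h
      exact h.trans (hB r hr)
    have hlim : Tendsto (fun r : ℕ => B * (r : ℝ) ^ (-b)) atTop (𝓝 0) := by
      have h := ((tendsto_rpow_neg_atTop hb).comp tendsto_natCast_atTop_atTop).const_mul B
      rw [mul_zero] at h
      exact h
    exact ge_of_tendsto hlim (eventually_atTop.2 ⟨1, hθ⟩)
  · rcases lt_or_eq_of_le p.2.2 with hp1 | hp1
    · -- main case `p_c < p < 1`, `r = ⌈p_c/s⌉`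
      set s : ℝ := (p : ℝ) - pc with hs
      have hs0 : 0 < s := by rw [hs]; linarith
      have hs1 : s ≤ 1 - pc := by rw [hs]; linarith [p.2.2]
      set r : ℕ := ⌈pc / s⌉₊ with hr
      have hr1 : 1 ≤ r := Nat.ceil_pos.2 (div_pos hpc0 hs0)
      have hrge : pc / s ≤ r := Nat.le_ceil _
      have hrle : (r : ℝ) ≤ pc / s + 1 := (Nat.ceil_lt_add_one (div_pos hpc0 hs0).le).le
      have hθ := theta_le_pow_mul_real_far_criticalProbI hd r p hpc hp1
      -- `(p/p_c)^r ≤ exp(1/p_c)`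
      have hgrow : ((p : ℝ) / pc) ^ r ≤ Real.exp (1 / pc) := by
        refine (div_pow_le_exp hpc0 hpc r).trans (Real.exp_le_exp.2 ?_)
        rw [← hs]
        calc (r : ℝ) * (s / pc) ≤ (pc / s + 1) * (s / pc) := mul_le_mul_of_nonneg_right hrle (by positivity)
          _ = 1 + s / pc := by field_simp
          _ ≤ 1 + (1 - pc) / pc := by gcongr
          _ = 1 / pc := by field_simp; ring
      -- `r^{-b} ≤ (p_c/s)^{-b} = s^b / p_c^b`
      have hdec : (r : ℝ) ^ (-b) ≤ s ^ b / pc ^ b := by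
        calc (r : ℝ) ^ (-b) ≤ (pc / s) ^ (-b) := Real.rpow_le_rpow_of_nonpos (div_pos hpc0 hs0) hrge (by linarith)
          _ = s ^ b / pc ^ b := by
              rw [Real.rpow_neg (div_nonneg hpc0.le hs0.le), ← Real.inv_rpow (div_nonneg hpc0.le hs0.le), inv_div,
                Real.div_rpow hs0.le hpc0.le]
      calc theta (zdGraph d) 0 p ≤ ((p : ℝ) / pc) ^ r * (B * (r : ℝ) ^ (-b)) :=
            hθ.trans (mul_le_mul_of_nonneg_left (hB r hr1) (pow_nonneg (div_nonneg (hpc0.le.trans hpc) hpc0.le) r))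
        _ ≤ Real.exp (1 / pc) * (B * (s ^ b / pc ^ b)) :=
            mul_le_mul hgrow (mul_le_mul_of_nonneg_left hdec hB0) (mul_nonneg hB0 (Real.rpow_nonneg (Nat.cast_nonneg r) _))
              (Real.exp_pos _).le
        _ = (Real.exp (1 / pc) * B * pc ^ (-b)) * s ^ b := by
            rw [Real.rpow_neg hpc0.le]; field_simp
        _ ≤ C * s ^ b := mul_le_mul_of_nonneg_right (le_max_left _ _) (Real.rpow_nonneg hs0.le _)
    · -- `p = 1`: `θ ≤ 1 = (1−p_c)^{-b} (1−p_c)^b ≤ C (1−p_c)^b`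
      have hs : (p : ℝ) - pc = 1 - pc := by rw [hp1]
      rw [hs]
      have hpos : 0 < (1 - pc) ^ b := Real.rpow_pos_of_pos (by linarith) b
      calc theta (zdGraph d) 0 p ≤ 1 := measureReal_le_one
        _ = (1 - pc) ^ (-b) * (1 - pc) ^ b := by rw [Real.rpow_neg (by linarith), inv_mul_cancel₀ hpos.ne']
        _ ≤ C * (1 - pc) ^ b := mul_le_mul_of_nonneg_right (le_max_right _ _) hpos.le

/-- **The dictionary for the SIXTH FACE of the landmark**: if Kozma–Nachmias' chemical one-arm supremum decays,
`Γ_{p_c}(r) = armSup d p_c r ≤ B r^{-b}` (`r ≥ 1`, `b > 0`), then `Quant.ThetaHolderNearCritical d b C` for an explicit `C` —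
the Hölder exponent of `θ` at `p_c⁺` is at least the chemical one-arm exponent (`β ≥ b_chem`; mean field: both `= 1`).
[cite: KozmaNachmias2009, §1.3 Thm. 1.2(ii)] [cite: Hutchcroft2022SlightlySupercritical, Lemma 2.1] -/
theorem thetaHolderNearCritical_of_armSup_le (hd : 2 ≤ d) {b B : ℝ} (hb : 0 < b)
    (hΓ : ∀ r : ℕ, 1 ≤ r → armSup d (criticalProbI d) r ≤ B * (r : ℝ) ^ (-b)) :
    ∃ C : ℝ, Quant.ThetaHolderNearCritical d b C :=
  ⟨_, thetaHolderNearCritical_of_real_far_le hd hb fun r hr => (real_far_le_armSup le_rfl _ 0 r).trans (hΓ r hr)⟩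

/-! ### §4. The triangle condition / high dimensions: `P_{p_c}(Rad_int ≥ r) ≍ 1/r` and `β ≥ 1` by the chemical route -/

/-- **Under the triangle condition the critical chemical one-arm probability is `≤ C/r`** (Kozma–Nachmias 2009 Thm 1.2(ii):
the mean-field volume tail `P_{p_c}(|C| ≥ n) ≤ C/√n` — tree, `exponents_of_triangle` — fed into their thin-layer recursion,
tree `Quant.chemicalArm_powerLaw_of_volumeTail` at `a = 1/2`). [cite: KozmaNachmias2009, §1.3 Thm. 1.2(ii)] -/
theorem real_far_criticalProbI_le_of_triangle (hd : 2 ≤ d) (hT : TriangleCondition d) :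
    ∃ C : ℝ, 0 < C ∧ ∀ r : ℕ, 1 ≤ r →
      (bondPercolation (zdGraph d) (criticalProbI d)).real (far (zdGraph d) (0 : Site d) r) ≤ C * (r : ℝ) ^ (-(1 : ℝ)) := by
  obtain ⟨-, -, -, C, hC⟩ := exponents_of_triangle hd hT
  have h' : ∀ k : ℕ, 1 ≤ k → (bondPercolation (zdGraph d) (criticalProbI d)).real (clusterSizeGe (0 : Site d) k) ≤
      C * (k : ℝ) ^ (-(1 / 2 : ℝ)) := fun k hk => by
    have h := hC k hk
    rwa [Real.sqrt_eq_rpow, div_eq_mul_inv, ← Real.rpow_neg (Nat.cast_nonneg k)] at h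
  obtain ⟨C', hC', hΓ⟩ := Quant.chemicalArm_powerLaw_of_volumeTail d (criticalProbI d) (a := 1 / 2) (by norm_num)
    (by norm_num) h'
  refine ⟨C', hC', fun r hr => (real_far_le_armSup le_rfl _ 0 r).trans ?_⟩
  have h := hΓ r hr
  norm_num at h
  exact h

/-- **TWO-SIDED under the triangle condition: `1/(e(r+3)) ≤ P_{p_c}(Rad_int(C(0)) ≥ r) ≤ C/r`** (`r ≥ 1`; the chemical one-arm
exponent equals `1`; lower half hypothesis-free, upper half Kozma–Nachmias). [cite: KozmaNachmias2009, §1.3 Thm. 1.2(ii)]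
[cite: HeydenreichVanDerHofstad2017, Thm. 11.5 (11.3.1)] -/
theorem real_far_criticalProbI_two_sided_of_triangle (hd : 2 ≤ d) (hT : TriangleCondition d) :
    ∃ C : ℝ, 0 < C ∧ ∀ r : ℕ, 1 ≤ r →
      1 / (Real.exp 1 * (r + 3)) ≤ (bondPercolation (zdGraph d) (criticalProbI d)).real (far (zdGraph d) (0 : Site d) r) ∧
      (bondPercolation (zdGraph d) (criticalProbI d)).real (far (zdGraph d) (0 : Site d) r) ≤ C / r := by
  obtain ⟨C, hC, h⟩ := real_far_criticalProbI_le_of_triangle hd hT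
  refine ⟨C, hC, fun r hr => ⟨real_far_criticalProbI_ge hd r, ?_⟩⟩
  have := h r hr
  rwa [Real.rpow_neg_one, ← div_eq_mul_inv] at this

/-- **HIGH DIMENSIONS, unconditionally: `∃ D > 6, ∀ d ≥ D`, `1/(e(r+3)) ≤ P_{p_c}(Rad_int(C(0)) ≥ r) ≤ C_d/r` for all `r ≥ 1`**
(triangle condition for `d ≥ D`: the tree's `HaraSlade1990_triangleCondition_holds`, standard axioms).
[cite: KozmaNachmias2009, §1.3 Thm. 1.2(ii)] [cite: HeydenreichVanDerHofstad2017, Thm. 11.5 (11.3.1), Open Problem 11.2] -/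
theorem real_far_criticalProbI_two_sided_high_dim :
    ∃ D : ℕ, 6 < D ∧ ∀ d : ℕ, D ≤ d → ∃ C : ℝ, 0 < C ∧ ∀ r : ℕ, 1 ≤ r →
      1 / (Real.exp 1 * (r + 3)) ≤ (bondPercolation (zdGraph d) (criticalProbI d)).real (far (zdGraph d) (0 : Site d) r) ∧
      (bondPercolation (zdGraph d) (criticalProbI d)).real (far (zdGraph d) (0 : Site d) r) ≤ C / r := by
  obtain ⟨D, hD, hT⟩ := Literature.Barriers.CriticalPhenomena.HaraSlade1990_triangleCondition_holds
  exact ⟨D, hD, fun d hd => real_far_criticalProbI_two_sided_of_triangle (by omega) (hT d hd)⟩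

/-- **`β ≥ 1` BY THE CHEMICAL ROUTE**: under the triangle condition, `θ(p) ≤ C (p − p_c)` for all `p ≥ p_c`
(`Quant.ThetaHolderNearCritical d 1 C`) — from `P_{p_c}(Rad_int ≥ r) ≤ C/r` and the lossless dictionary; a third kernel route
to Barsky–Aizenman's upper bound (the tree has Hutchcroft's Thm 1.3 route and the volume-transfer route).
[cite: Hutchcroft2022SlightlySupercritical, Lemma 2.1] [cite: BarskyAizenman1991, Thm. 1.1 (β = 1)] -/
theorem thetaHolder_one_of_triangle_chemical (hd : 2 ≤ d) (hT : TriangleCondition d) :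
    ∃ C : ℝ, Quant.ThetaHolderNearCritical d 1 C := by
  obtain ⟨C, -, h⟩ := real_far_criticalProbI_le_of_triangle hd hT
  exact ⟨_, thetaHolderNearCritical_of_real_far_le hd one_pos h⟩

end ChemRad

end Summit.CriticalPhenomena.PercolationContinuityZ3.Theorems

end
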